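import Literature.AlgebraicGeometry.Resolution.EmbeddedResolutionExcellentSurfaces
import Literature.AlgebraicGeometry.Resolution.StrictNormalCrossingsPoints
import Literature.AlgebraicGeometry.Resolution.StalkIdealLemmas
import Literature.AlgebraicGeometry.Resolution.RsopLocalization
import Mathlib.RingTheory.Ideal.KrullsHeightTheorem
import HarnessLib

/-!
# A regular subscheme transversal to a strict normal crossings divisor: when the union is snc

Topic: `Literature/AlgebraicGeometry/Resolution`. The local algebra behind the last step of the
proof of Cossart–Piltant 2019, Thm. 1.1 (iii) (v1 = arXiv:1412.0868v1, p. 50: "Suppose that (i)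
and (ii) in Theorem 1.1 have been proved. Apply proposition 4.2 [= Cossart–Jannsen–Saito,
embedded resolution in dimension two, with `ℬ = ∅`] to `𝒳 := π⁻¹(Sing 𝒳)_red ⊆ 𝒳'` …: we get
(iii)"), in the language of the tree's rendering of CJS 2020 Thm. 1.4 / Cor. 1.5
(`CossartJannsenSaito2020Embedded`, `EmbeddedResolutionExcellentSurfaces.lean`): the output of
CJS is a regular `X₁ ⊆ Z₁` *transversal* (CJS Def. 4.1, `IsTransversalWith`) with a strict normal
crossings divisor `B₁`, and `π⁻¹(X) = X₁ ∪ B₁`. The union `X₁ ∪ B₁` is a strict normal crossings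
divisor on `Z₁` as soon as it is, locally at each point of `X₁`, the zero set of ONE non-zero
function — which is the case when `X ⊆ Z` was (set-theoretically) an effective Cartier divisor,
e.g. the exceptional locus of a blowing up. PROVED here over Mathlib:

* `IsRsopPart.eq_one_and_exists_of_inf_eq_radical` — LOCAL ALGEBRA [folklore; Matsumura Thms.
  14.2, 14.3, 17.4 with Krull's principal ideal theorem]: in a regular local ring `R` let
  `z₁, …, z_r, w₁, …, w_e` be part of a regular system of parameters and `J ⊆ {1, …, e}`; if
  `(z₁, …, z_r) ∩ (∏_{j∈J} w_j) = √(g)` for some `g ≠ 0`, then `r = 1` (Krull: the prime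
  `(z₁, …, z_r)`, of height `r`, is minimal over `(g)`; and `r = 0` would force `g = 0`) and the
  intersection is `(z₁ · ∏_{j∈J} w_j)`, the ideal of the product of the part `(w_j)_{j∈J}, z₁` of
  a regular system of parameters.
* `IsTransversalWith.isStrictNormalCrossingsDivisor_union` — for `D ⊆ Z` closed and transversal
  with the strict normal crossings divisor `B` (CJS Def. 4.1; de Jong 2.4), if at every point of
  `D` the ideal of `D ∪ B` is the radical of a non-zero principal ideal, then `D ∪ B` is a strict
  normal crossings divisor (at points of `B ∖ D` the local picture of `B` is that of `D ∪ B`).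
* `IsEmbeddedTransform.isClosed_transform` — the iterated strict transform of a closed set is
  closed (bookkeeping for `IsEmbeddedTransform`, `EmbeddedResolution.lean`).

Used by `CossartPiltant200819/GoodResolutionOneBlowup2019.lean` (CP 2019 Thm. 1.1 (iii) for the
one-blow-up resolution of a threefold over a field).

## Sources

* V. Cossart, O. Piltant, *Resolution of singularities of arithmetical threefolds*, J. Algebra 529
  (2019) 268–535 = arXiv:1412.0868 (v1: Prop. 4.2 and the paragraph following Prop. 4.4, p. 50).
  [CossartPiltant2019]
* V. Cossart, U. Jannsen, S. Saito, *Desingularization: Invariants and Strategy*, LNM 2270 (2020):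
  Def. 4.1 (p. 49), Thm. 1.4, proof of Cor. 1.5 (p. 7). [CossartJannsenSaito2020]
* A. J. de Jong, *Smoothness, semi-stability and alterations*, Publ. Math. IHÉS 83 (1996), 2.4.
  [DeJong1996]
* H. Matsumura, *Commutative Ring Theory* (1987), Thms. 13.5, 14.2, 14.3, 17.4. [Matsumura1987]

AI-generated formalisation (cell `pub-hironaka`, CP carver); statements are the tree's own
renderings, see the faithfulness notes of the files cited above.
-/

noncomputable section

open CategoryTheory AlgebraicGeometry TopologicalSpace IsLocalRing

namespace Literature.AlgebraicGeometry.Resolution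

universe u

open Scheme.IdealSheafData

/-! ## Tuples: the range of an appended family -/

/-- `range (Fin.append u v) = range u ∪ range v`. [folklore] -/
private theorem range_fin_append'' {α : Type*} {m n : ℕ} (u : Fin m → α) (v : Fin n → α) :
    Set.range (Fin.append u v) = Set.range u ∪ Set.range v := by
  ext a
  constructor
  · rintro ⟨i, rfl⟩
    induction i using Fin.addCases with
    | left j => exact Or.inl ⟨j, by simp⟩
    | right k => exact Or.inr ⟨k, by simp⟩
  · rintro (⟨j, rfl⟩ | ⟨k, rfl⟩)
    · exact ⟨Fin.castAdd n j, by simp⟩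
    · exact ⟨Fin.natAdd m k, by simp⟩

/-! ## Local algebra: a prime part of a regular system of parameters meeting a monomial -/

namespace IsRsopPart

variable {R : Type u} [CommRing R] [IsLocalRing R]

/-- If `(z, w)` is part of a regular system of parameters, no `w_j` lies in the prime ideal
`(z₁, …, z_r)`. [cite: Matsumura1987, Thm. 14.2] -/
theorem append_right_not_mem_span_range_left {r e : ℕ} {z : Fin r → R} {w : Fin e → R}
    (hzw : IsRsopPart (Fin.append z w)) (j : Fin e) : w j ∉ Ideal.span (Set.range z) := by
  intro hj
  have hrange : Set.range z = Fin.append z w '' Set.range (Fin.castAdd e) := by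
    ext a
    simp only [Set.mem_range, Set.mem_image, exists_exists_eq_and, Fin.append_left]
  refine hzw.not_mem_span_image (S := Set.range (Fin.castAdd e)) (i := Fin.natAdd r j) ?_ ?_
  · rintro ⟨i, hi⟩
    have h1 : (Fin.castAdd e i : ℕ) = (Fin.natAdd r j : ℕ) := congrArg Fin.val hi
    rw [Fin.val_natAdd, Fin.val_castAdd] at h1
    have h2 := i.2
    omega
  · rwa [Fin.append_right, ← hrange]

/-- **Local algebra of CP 2019, Thm. 1.1 (iii).** Let `z₁, …, z_r, w₁, …, w_e` be part of a
regular system of parameters of the (regular) local ring `R`, `J ⊆ {1, …, e}`, and suppose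
`(z₁, …, z_r) ∩ (∏_{j∈J} w_j) = √(g)` for some `g ≠ 0`. Then `r = 1`, and the intersection is the
ideal `(∏ᵢ xᵢ)` of the product of the part `x = ((w_j)_{j ∈ J}, z₁)` of a regular system of
parameters. Indeed `r ≥ 1` since `g ≠ 0`; the prime `P = (z)` (Matsumura 14.3) is minimal over
`(g)` — a prime `Q` with `(g) ⊆ Q ⊆ P` contains `√(g) ⊇ P · (∏ w_j)`, and `∏_{j∈J} w_j ∉ P` — so
`r = ht P ≤ 1` by Krull's principal ideal theorem (Matsumura 13.5) and `ht (z₁,…,z_r) = r`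
(17.4); finally `(∏ w_j) ∩ (z₁) = (z₁ · ∏ w_j)` (`span_prod_inf_span_range`).
[cite: Matsumura1987, Thm. 13.5; Thm. 14.2; Thm. 17.4 (iii)] -/
theorem eq_one_and_exists_of_inf_eq_radical {r e : ℕ} {z : Fin r → R} {w : Fin e → R}
    (hzw : IsRsopPart (Fin.append z w)) (J : Finset (Fin e)) {g : R} (hg : g ≠ 0)
    (hrad : Ideal.span (Set.range z) ⊓ Ideal.span {∏ j ∈ J, w j} = (Ideal.span {g}).radical) :
    r = 1 ∧ ∃ x : Fin (J.card + 1) → R, IsRsopPart x ∧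
      Ideal.span (Set.range z) ⊓ Ideal.span {∏ j ∈ J, w j} = Ideal.span {∏ i, x i} := by
  classical
  haveI := hzw.isRegularLocalRing
  haveI := isDomain_of_isRegularLocalRing R
  have hz : IsRsopPart z := hzw.append_left
  set P : Ideal R := Ideal.span (Set.range z) with hPdef
  set F : Ideal R := Ideal.span {∏ j ∈ J, w j} with hFdef
  haveI hP : P.IsPrime := hz.isPrime_span_range
  -- `∏_{j ∈ J} w_j ∉ P`
  have hprodP : ∏ j ∈ J, w j ∉ P := by
    intro hmem
    obtain ⟨j, -, hj⟩ := (Ideal.IsPrime.prod_mem_iff (hp := hP)).mp hmem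
    exact hzw.append_right_not_mem_span_range_left j hj
  -- `(g) ≤ P`
  have hgP : Ideal.span {g} ≤ P :=
    (Ideal.le_radical.trans hrad.symm.le).trans inf_le_left
  -- `r ≥ 1`
  have hr1 : 1 ≤ r := by
    by_contra hr0
    have hr0' : r = 0 := by omega
    subst hr0'
    have hP0 : P = ⊥ := by
      rw [hPdef, Set.range_eq_empty, Ideal.span_empty]
    have hgmem : g ∈ (Ideal.span {g}).radical := Ideal.le_radical (Ideal.mem_span_singleton_self g)
    rw [← hrad, hP0, bot_inf_eq] at hgmem
    exact hg ((Submodule.mem_bot R).mp hgmem)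
  -- `P` is a minimal prime of `(g)`
  have hmin : P ∈ (Ideal.span {g}).minimalPrimes := by
    refine ⟨⟨hP, hgP⟩, fun Q hQ hQP => ?_⟩
    haveI : Q.IsPrime := hQ.1
    have hradQ : (Ideal.span {g}).radical ≤ Q := (Ideal.IsPrime.radical_le_iff hQ.1).mpr hQ.2
    have hPFQ : P * F ≤ Q := Ideal.mul_le_inf.trans (hrad.le.trans hradQ)
    rcases (Ideal.IsPrime.mul_le (hp := hQ.1)).mp hPFQ with hPQ | hFQ
    · exact hPQ
    · exact absurd (hQP (hFQ (Ideal.mem_span_singleton_self _))) hprodP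
  -- Krull: `ht P ≤ 1`, while `ht P = r`
  have hheight : P.height ≤ 1 :=
    Ideal.height_le_one_of_isPrincipal_of_mem_minimalPrimes (Ideal.span {g}) P hmin
  rw [hPdef, hz.height_span_range] at hheight
  have hr : r = 1 := le_antisymm (by exact_mod_cast hheight) hr1
  subst hr
  refine ⟨rfl, ?_⟩
  -- the part `x = ((w_j)_{j∈J}, z₁)` of a regular system of parameters
  let w' : Fin J.card → R := w ∘ J.orderEmbOfFin rfl
  let ι : Fin (J.card + 1) → Fin (1 + e) :=
    Fin.append (Fin.natAdd 1 ∘ J.orderEmbOfFin rfl) (Fin.castAdd e)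
  have hι : Function.Injective ι := by
    intro a b hab
    induction a using Fin.addCases with
    | left a =>
      induction b using Fin.addCases with
      | left b =>
        simp only [ι, Fin.append_left, Function.comp_apply] at hab
        exact congrArg (Fin.castAdd 1) ((J.orderEmbOfFin rfl).injective (Fin.natAdd_injective _ _ hab))
      | right b =>
        simp only [ι, Fin.append_left, Fin.append_right, Function.comp_apply] at hab
        have h1 := congrArg Fin.val hab
        rw [Fin.val_natAdd, Fin.val_castAdd] at h1
        have h2 := b.2
        omega
    | right a =>
      induction b using Fin.addCases with
      | left b =>
        simp only [ι, Fin.append_left, Fin.append_right, Function.comp_apply] at hab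
        have h1 := congrArg Fin.val hab
        rw [Fin.val_natAdd, Fin.val_castAdd] at h1
        have h2 := a.2
        omega
      | right b =>
        simp only [ι, Fin.append_right] at hab
        exact congrArg (Fin.natAdd J.card) (Fin.castAdd_injective _ _ hab)
  have hcomp : Fin.append z w ∘ ι = Fin.append w' z := by
    funext a
    induction a using Fin.addCases with
    | left a => simp [ι, w']
    | right a => simp [ι]
  have hx : IsRsopPart (Fin.append w' z) := hcomp ▸ hzw.comp ι hι
  refine ⟨Fin.append w' z, hx, ?_⟩
  -- `∏_{j∈J} w_j = ∏_k w'_k`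
  have hprod : ∏ k, w' k = ∏ j ∈ J, w j := by
    rw [← Finset.prod_coe_sort J w]
    exact Fintype.prod_equiv (J.orderIsoOfFin rfl).toEquiv _ _ fun k => by
      simp [w', Finset.coe_orderIsoOfFin_apply]
  -- `(∏ w') ∩ (z₁) = (∏ w') · (z₁) = (∏ w' · z₁)`
  have hz0 : Set.range z = {z 0} := by
    rw [Set.range_unique]
    rfl
  calc Ideal.span (Set.range z) ⊓ Ideal.span {∏ j ∈ J, w j}
      = Ideal.span {∏ k, w' k} ⊓ Ideal.span (Set.range z) := by rw [hprod, inf_comm]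
    _ = Ideal.span {∏ k, w' k} * Ideal.span (Set.range z) := hx.span_prod_inf_span_range
    _ = Ideal.span {(∏ k, w' k) * z 0} := by
        rw [hz0, Ideal.span_singleton_mul_span_singleton]
    _ = Ideal.span {∏ i, Fin.append w' z i} := by
        rw [Fin.prod_univ_add]
        simp

end IsRsopPart

/-! ## The union of a transversal pair is a strict normal crossings divisor -/

/-- **`D ∪ B` is a strict normal crossings divisor** when `D` is closed and transversal with the
strict normal crossings divisor `B` (CJS 2020 Def. 4.1: at `x ∈ D` a regular system of parameters
`(z, w)` of `𝒪_{Z,x}` with `I(D)_x = (z)` and `I(B)_x = (∏_{j∈J} w_j)`), provided that at every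
point of `D` the ideal of `D ∪ B` is the radical of a non-zero principal ideal (e.g. `D ∪ B` is
the support of an effective Cartier divisor on an integral `Z`): at `x ∈ D`,
`I(D ∪ B)_x = (z) ∩ (∏ w_j) = √(g)` forces `z = (z₁)` and `I(D ∪ B)_x = (z₁ ∏_{j∈J} w_j)`
(`IsRsopPart.eq_one_and_exists_of_inf_eq_radical`); at `x ∈ B ∖ D`, `I(D ∪ B)_x = I(B)_x`.
This is the content of the sentence "we get (iii)" of CP 2019 (v1 p. 50) once CJS Prop. 4.2 has
produced `π⁻¹(X) = X₁ ∪ B₁` with `X₁` transversal to `B₁`.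
[cite: CossartJannsenSaito2020, Def. 4.1, p. 49] [cite: DeJong1996, 2.4, p. 55]
[cite: CossartPiltant2019, §4.1, paragraph after Prop. 4.4 (v1 p. 50)] -/
theorem IsTransversalWith.isStrictNormalCrossingsDivisor_union {Z : Scheme.{u}} {D B : Set Z}
    (htr : IsTransversalWith Z D B) (hB : IsStrictNormalCrossingsDivisor Z B) (hD : IsClosed D)
    (hrad : ∀ x ∈ D, ∃ g : Z.presheaf.stalk x, g ≠ 0 ∧
      stalkIdeal (vanishingIdeal ⟨closure (D ∪ B), isClosed_closure⟩) x =
        (Ideal.span {g}).radical) :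
    IsStrictNormalCrossingsDivisor Z (D ∪ B) := by
  classical
  have hBc : IsClosed B := hB.isClosed
  rw [isStrictNormalCrossingsDivisor_iff_stalkIdeal] at hB ⊢
  refine ⟨hD.union hBc, fun p hp => ?_⟩
  -- the ideal of `D ∪ B` is `I(D) ∩ I(B)`, stalkwise
  have hclos : (⟨closure (D ∪ B), isClosed_closure⟩ : Closeds Z) =
      (⟨closure D, isClosed_closure⟩ : Closeds Z) ⊔ ⟨closure B, isClosed_closure⟩ := by
    apply Closeds.ext
    simp [closure_union]
  have hinf : stalkIdeal (vanishingIdeal ⟨closure (D ∪ B), isClosed_closure⟩) p =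
      stalkIdeal (vanishingIdeal ⟨closure D, isClosed_closure⟩) p ⊓
        stalkIdeal (vanishingIdeal ⟨closure B, isClosed_closure⟩) p := by
    rw [hclos, vanishingIdeal_sup, stalkIdeal_inf]
  by_cases hpD : p ∈ D
  · -- at a point of `D`: the transversal parameters
    obtain ⟨hreg, r, e, z, w, J, hdim, hspan, hDp, hBp⟩ := htr p hpD
    obtain ⟨g, hg, hg'⟩ := hrad p hpD
    have hzw : IsRsopPart (Fin.append z w) := by
      refine ⟨hreg, 0, Fin.elim0, by simpa using hdim, ?_⟩
      rw [range_fin_append'', Set.range_eq_empty Fin.elim0, Set.union_empty, hspan]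
    rw [hinf, hDp, hBp] at hg'
    obtain ⟨-, x, hx, hx'⟩ := hzw.eq_one_and_exists_of_inf_eq_radical J hg hg'
    obtain ⟨-, e', y, hdim', hspan'⟩ := hx
    refine ⟨hreg, J.card + 1, e', x, y, by omega, hdim', hspan', ?_⟩
    rw [hinf, hDp, hBp, hx']
  · -- off `D`: the picture of `B`
    have hpB : p ∈ B := hp.resolve_left hpD
    obtain ⟨hreg, r, e, x, y, hr, hdim, hspan, hBp⟩ := hB.2 p hpB
    refine ⟨hreg, r, e, x, y, hr, hdim, hspan, ?_⟩
    have htop : stalkIdeal (vanishingIdeal ⟨closure D, isClosed_closure⟩) p = ⊤ := by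
      apply stalkIdeal_eq_top_of_not_mem_support
      rw [← SetLike.mem_coe, coe_support_vanishingIdeal]
      change p ∉ closure D
      rwa [hD.closure_eq]
    rw [hinf, htop, top_inf_eq, hBp]

/-! ## Strict transforms of closed sets are closed -/

/-- The iterated strict transform of a closed subset along an embedded transform is closed.
[folklore] -/
theorem IsEmbeddedTransform.isClosed_transform {X : Scheme.{u}} {Y T : Set X} (hY : IsClosed Y)
    {X' : Scheme.{u}} {σ : X' ⟶ X} {Y' : Set X'} (h : IsEmbeddedTransform Y T σ Y') :
    IsClosed Y' := by
  induction h with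
  | refl => exact hY
  | blowup => exact isClosed_closure

end Literature.AlgebraicGeometry.Resolution

end
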